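import Literature.NumberTheory.Weil1964.AdelicMetaplecticArchRep
import Literature.NumberTheory.Weil1964.ArchSchrodingerFollandDictionary
import HarnessLib

/-!
# Archimedean Heisenberg covariance and coefficient continuity of the read-off `ω_∞(h) = archRepMp s h`

Origin: `pub-hodgecm` MODEL-CONSTRUCTION sub-cell, construction prover `mc-theta-2` (gen 5), node W6a
(W-⊗′)/(W-ω) of `MODEL-DAG.md`, follow-up leaf D2 of `AdelicMetaplecticArchRep`. KERNEL MATHEMATICS ONLY: theorems
over tree declarations; no `def`, no `def … : Prop` record, no `axiom`, no proof hole. A REPRODUCTION of a published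
statement (Literature side).

THE STATEMENT. Let `s : H →* Mp_ψ(W_𝔸)ᶜᵒⁿᵗ` be a homomorphism whose symplectic components fix the finite Heisenberg
elements, so that `ω(s h) = ω_∞(h) ⊗ 1` with `ω_∞ = archRepMp s` (`AdelicMetaplecticArchRep`,
`omega_eq_adelicTensorEnd_archRepMp`). The dictionary `ArchSchrodingerFollandDictionary` (`arch_covariant_of_implements`)
transfers the defining covariance `M ρ(w) = ρ(g·w) M` of a pair `(g, M) ∈ Mp_ψ(W_𝔸)` over the ARCHIMEDEAN Heisenberg
elements to the archimedean factor of any tensor decomposition `M = A ⊗ M_f` (`M_f ≠ 0`). Applied to the decomposition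
`ω(s h) = archRepMp s h ⊗ 1` (`M_f = 1`, test vector `𝟙_{𝒪̂^ι}`):

* `archRepMp_archModTrans` — **Weil's form**: `ω_∞(h) (archModTrans T a w Φ) = ψ_F(f_g(V)) • archModTrans T a' w' (ω_∞(h) Φ)`,
  `g = π(s h)`, `V = (archVec a, archVec w)`, `(archVec a', archVec w') = g V`, `f_g` Weil's quadratic character of the
  section `ofSymplectic`;
* `archRepMp_rhoSD` — **Folland's form**: in real coordinates `e : (ι → F ⊗ ℝ) ≃L[ℝ] (σ → ℝ)`,
  `ω_∞(h) ρ_D(p, q) = follandCocycle e g (a, w) • ρ_D(p', q') ω_∞(h)` — PROJECTIVE covariance over Folland's Schrödinger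
  representation `rhoSD e` with a nowhere-zero cocycle (`follandCocycle_ne_zero`), the hypothesis shape of the
  Stone–von Neumann uniqueness statements of `Literature.Analysis.SegalBargmann`.

* `archRepMp_apply_apply_eq`, `continuous_archRepMp_apply_apply` — the read-off IS a matrix coefficient of `ω`,
  `(ω_∞(h) Φ)(a) = (ω(s h)(Φ ⊗ 𝟙_{x₀ + 𝔫𝒪̂^ι}))(a, x₀)`, hence `h ↦ (ω_∞(h) Φ)(a)` is continuous for a continuous `s`
  (topology of `AdelicMetaplecticGroup` §4). [Weil1964, Chap. III n° 39 p. 189]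

USE (pub-hodgecm). Junction-identification lanes compare the read-off `ω_∞` with archimedean junction data up to a
scalar through Stone–von Neumann uniqueness; no tensor product of Schwartz operators is constructed anywhere.

## References

* [MoeglinVignerasWaldspurger1987] C. Mœglin, M.-F. Vignéras, J.-L. Waldspurger, *Correspondances de Howe sur un corps
  p-adique*, LNM 1291 (1987), Chap. 2 II.1 (A) (the pairs `(g, M)`, `M ρ(w) M⁻¹ = ρ(g w)`).
* [Weil1964] A. Weil, *Sur certains groupes d'opérateurs unitaires*, Acta Math. 111 (1964), Chap. I n° 5 pp. 150–151
  (the section `σ ↦ (σ, f_σ)`), Chap. III n° 37–38 pp. 188–190 (`𝐫_𝐀 = ⊗_v 𝐫_v`, archimedean factor).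
* [Folland1989] G. B. Folland, *Harmonic Analysis in Phase Space*, Princeton UP (1989), Prop. (1.43).

## Provenance

LEAN-IN-TREE rule (2026-08-18), pub-hodgecm model-construction sub-cell, seat mc-theta-2 gen 5; node W6a (W-⊗′)/(W-ω)
(RULING (WW′) 2026-08-19 02:35Z), follow-up of `AdelicMetaplecticArchRep` (bytes of record b2734cb633cf).
-/

set_option autoImplicit false

noncomputable section

open scoped Matrix SchwartzMap TensorProduct Classical
open NumberField NumberField.mixedEmbedding IsDedekindDomain

namespace Literature.NumberTheory.Weil1964

open Literature.NumberTheory.Automorphic Literature.RepresentationTheory.HeisenbergGroup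
open Literature.Analysis.SegalBargmann

variable {F : Type} [Field F] [NumberField F] {ι : Type} [Fintype ι]

/-- The finite test vector `𝟙_{𝒪̂^ι}` is nonzero under `1 = LinearMap.id` (its value at `0` is `1`); cf.
`indicatorSB_top_ne_zero` of `AdelicMetaplecticTensorSchur` (not imported, to keep the import cone small). [folklore] -/
theorem id_indicatorSB_top_ne_zero :
    (LinearMap.id : FinSB F ι →ₗ[ℂ] FinSB F ι)
      (indicatorSB F ι (piLevelIdeal F ι ⊤) (isOpen_piLevelIdeal F ⊤) (isCompact_piLevelIdeal F ι ⊤)) ≠ 0 := by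
  intro h
  have h0 := congrArg (fun f : FinSB F ι => (f : (ι → FiniteAdeleRing (𝓞 F) F) → ℂ) 0) h
  simp only [LinearMap.id_apply, coe_indicatorSB,
    Set.indicator_of_mem (piLevelIdeal F ι ⊤).zero_mem] at h0
  exact one_ne_zero h0

variable [DecidableEq ι] {T : Matrix ι ι (AdeleRing (𝓞 F) F)}

/-- `(π p, ω p)` implements `π p` on the global Schrödinger representation: membership in `Mp_ψ(W_𝔸)`, restated for
`p ∈ Mp_ψ(W_𝔸)ᶜᵒⁿᵗ` through `adelicMpCont.proj`. [cite: MoeglinVignerasWaldspurger1987, Chap. 2 II.1 (A)] -/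
theorem implements_adelicMpCont_proj (p : adelicMpCont F ι T) :
    Implements (adelicSchrodinger F ι T)
      (ofSymplectic (polar (adelicForm F ι T)) (adelicMpCont.proj F ι T p))
      ((p : adelicMp F ι T) : symplecticGroup (polar (adelicForm F ι T)) ×
        (piSchwartzBruhat F ι ≃ₗ[ℂ] piSchwartzBruhat F ι)).2 :=
  (mem_MpPsi _ _).1 (p : adelicMp F ι T).2

variable {H : Type*} [Group H]
variable (hTy : Function.Surjective fun y : ι → AdeleRing (𝓞 F) F => T *ᵥ y) (s : H →* adelicMpCont F ι T)
  (hfin : ∀ h : H, ∀ w ∈ finHeisenberg T,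
    (ofSymplectic (polar (adelicForm F ι T)) (adelicMpCont.proj F ι T (s h))).act w = w)

/-- **Archimedean covariance of the read-off, Weil's form**: for `p = s h` with `π p = g`,
`archRepMp s h (archModTrans T a w Φ) = ψ_F(f_g(V)) • archModTrans T a' w' (archRepMp s h Φ)`, where
`V = (archVec a, archVec w)` and `(archVec a', archVec w') = g V`.
[cite: MoeglinVignerasWaldspurger1987, Chap. 2 II.1 (A); Weil1964, Chap. I n° 5 p. 150–151] -/
theorem archRepMp_archModTrans (h : H) (a w : ι → mixedSpace F) (Φ : 𝓢((ι → mixedSpace F), ℂ)) :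
    archRepMp hTy s hfin h (archModTrans F ι T a w Φ) =
      weilPhase T (adelicMpCont.proj F ι T (s h)) (a, w) •
        archModTrans F ι T (archAct T (adelicMpCont.proj F ι T (s h)) (a, w)).1
          (archAct T (adelicMpCont.proj F ι T (s h)) (a, w)).2 (archRepMp hTy s hfin h Φ) :=
  arch_covariant_of_implements T (adelicMpCont.proj F ι T (s h)) _ (implements_adelicMpCont_proj (s h))
    (archRepMp hTy s hfin h) LinearMap.id (fun Φ' f => omega_map_tmul hTy s hfin h Φ' f)
    id_indicatorSB_top_ne_zero a w Φ

variable {σ : Type*} [Fintype σ]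

/-- **Archimedean covariance of the read-off, Folland's form**: in real coordinates
`e : (ι → F ⊗ ℝ) ≃L[ℝ] (σ → ℝ)`, with `p = e a`, `q = follandFreq e (T_∞ w)`, `(a', w') = archAct g (a, w)`,
`archRepMp s h (ρ_D(p, q) Φ) = follandCocycle e g (a, w) • ρ_D(p', q') (archRepMp s h Φ)` — PROJECTIVE covariance over
Folland's Schrödinger representation with a nowhere-zero cocycle (`follandCocycle_ne_zero`).
[cite: Folland1989, Prop. (1.43); MoeglinVignerasWaldspurger1987, Chap. 2 II.1 (A)] -/
theorem archRepMp_rhoSD (e : (ι → mixedSpace F) ≃L[ℝ] (σ → ℝ)) (h : H) (a w : ι → mixedSpace F)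
    (Φ : 𝓢((ι → mixedSpace F), ℂ)) :
    archRepMp hTy s hfin h (rhoSD e (e a) (follandFreq F ι e (archMat F ι T *ᵥ w)) Φ) =
      follandCocycle T e (adelicMpCont.proj F ι T (s h)) (a, w) •
        rhoSD e (e (archAct T (adelicMpCont.proj F ι T (s h)) (a, w)).1)
          (follandFreq F ι e (archMat F ι T *ᵥ (archAct T (adelicMpCont.proj F ι T (s h)) (a, w)).2))
          (archRepMp hTy s hfin h Φ) :=
  arch_covariant_rhoSD_of_implements T e (adelicMpCont.proj F ι T (s h)) _ (implements_adelicMpCont_proj (s h))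
    (archRepMp hTy s hfin h) LinearMap.id (fun Φ' f => omega_map_tmul hTy s hfin h Φ' f)
    id_indicatorSB_top_ne_zero a w Φ

/-! ### Continuity of the matrix coefficients of the read-off in `h` -/

/-- **The read-off as a matrix coefficient of `ω`**: `(archRepMp s h Φ)(a) = (ω(s h)(Φ ⊗ 𝟙_{x₀ + 𝔫𝒪̂^ι}))(a, x₀)`.
[folklore] -/
theorem archRepMp_apply_apply_eq (h : H) (x₀ : ι → FiniteAdeleRing (𝓞 F) F) (𝔫 : Ideal (𝓞 F))
    (Φ : 𝓢((ι → mixedSpace F), ℂ)) (a : ι → mixedSpace F) :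
    archRepMp hTy s hfin h Φ a =
      ((adelicMpCont.omega F ι T (s h) (thinCosetTestFunₗ (K := F) (ι := ι) x₀ 𝔫 Φ) : piSchwartzBruhat F ι) :
        (ι → AdeleRing (𝓞 F) F) → ℂ) (piAdeleSplit F ι (a, x₀)) := by
  rw [omega_thinCosetTestFunₗ, ← archSliceLM_apply_apply, archSliceLM_thinCosetTestFunₗ]

/-- **Continuity of the matrix coefficients `h ↦ (archRepMp s h Φ)(a)`** for a CONTINUOUS homomorphism `s` into
`Mp_ψ(W_𝔸)ᶜᵒⁿᵗ` (topology of `AdelicMetaplecticGroup` §4: initial for `π` and the pointwise matrix coefficients of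
`ω_ψ`). [cite: Weil1964, Chap. III n° 39 p. 189] -/
theorem continuous_archRepMp_apply_apply [TopologicalSpace H] (hs : Continuous s)
    (Φ : 𝓢((ι → mixedSpace F), ℂ)) (a : ι → mixedSpace F) :
    Continuous fun h => archRepMp hTy s hfin h Φ a := by
  have heq : (fun h => archRepMp hTy s hfin h Φ a) = fun h =>
      ((omegaPsi (adelicSchrodinger F ι T) ((s h : adelicMpCont F ι T) : adelicMp F ι T)
        (thinCosetTestFunₗ (K := F) (ι := ι) 0 ⊤ Φ) : piSchwartzBruhat F ι) : (ι → AdeleRing (𝓞 F) F) → ℂ)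
          (piAdeleSplit F ι (a, 0)) :=
    funext fun h => archRepMp_apply_apply_eq hTy s hfin h 0 ⊤ Φ a
  rw [heq]
  exact (continuous_omegaPsi_apply _ _).comp (continuous_subtype_val.comp hs)


end Literature.NumberTheory.Weil1964

end
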